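import Mathlib
import Summits.KontsevichZagierPeriods.Zeta5Search.Families.CoeffAsympLimit
import Summits.KontsevichZagierPeriods.Zeta5Search.Families.CoeffAsympInf
import HarnessLib

/-!
# ζ(5) search — Families: coefficient asymptotics of powers of a positive polynomial — the packaged theorem

HONEST FRAMING: systematic search; no irrationality claim unless certified.  Cell `pub-zeta5`, certifier 2
(cert-2 g9, 2026-08-22).  Elementary real analysis; no conjecture node is used; nothing about `ζ(5)`.

The user-facing form of `Families/CoeffAsymp{Types,Face,Minimizer,Rational,Entropy,Lower,Limit,Inf}`:
* **`tendsto_log_coeff_div_iInf`** — for `c > 0` on the finite set of monomials `S` and `B ∈ S`: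
  `(1/n)·log [x^{nB}] (poly S c)ⁿ → log ⨅_u Σ_{α ∈ S} c_α e^{(α−B)·u}`;
* **`MvPolynomial`-form `tendsto_log_coeff_pow_div`** — for ANY `P : MvPolynomial (Fin d) ℝ` with non-negative
  coefficients and `[x^B] P ≠ 0`: `(1/n)·log [x^{nB}] Pⁿ → log ⨅_{u ∈ ℝ^d} Σ_{α ∈ supp P} ([x^α]P) e^{(α−B)·u}`
  (= `log inf_{x > 0} P(x)/x^B`).  This is the constant-term asymptotics behind every "torus period" of a Laurent
  polynomial with non-negative coefficients (the growth of Apéry-like leading coefficients, [MOS20]-type sequences).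
Standard axioms only.
-/

noncomputable section

open MvPolynomial Finset Real Filter Topology

namespace Summit.KontsevichZagierPeriods.Zeta5Search.Families.Cellular

namespace CoeffAsymp

variable {d : ℕ}

/-- **Coefficient asymptotics, packaged**: `(1/n)·log [x^{nB}] (poly S c)ⁿ → log ⨅_u tilt S c B u`. -/
theorem tendsto_log_coeff_div_iInf {S : Finset (Fin d →₀ ℕ)} {c : (Fin d →₀ ℕ) → ℝ} (hc : ∀ α ∈ S, 0 < c α)
    {B : Fin d →₀ ℕ} (hB : B ∈ S) :
    Tendsto (fun n : ℕ => Real.log (coeff (n • B) (poly S c ^ n)) / n) atTop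
      (𝓝 (Real.log (⨅ u : Fin d → ℝ, tilt S c B u))) := by
  obtain ⟨u₀, hmin⟩ := exists_tilt_face_min hc hB
  rw [iInf_tilt_eq_tilt_face_min hc hmin]
  exact tendsto_log_coeff_div hc hB hmin

/-- **`MvPolynomial` form**: for `P` with non-negative real coefficients and `[x^B] P ≠ 0`,
`(1/n)·log [x^{nB}] Pⁿ → log ⨅_u Σ_{α ∈ supp P} ([x^α] P)·e^{(α−B)·u}`. -/
theorem tendsto_log_coeff_pow_div (P : MvPolynomial (Fin d) ℝ) (hP : ∀ m, 0 ≤ coeff m P) {B : Fin d →₀ ℕ}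
    (hB : coeff B P ≠ 0) :
    Tendsto (fun n : ℕ => Real.log (coeff (n • B) (P ^ n)) / n) atTop
      (𝓝 (Real.log (⨅ u : Fin d → ℝ, tilt P.support (fun m => coeff m P) B u))) := by
  have hc : ∀ m ∈ P.support, 0 < coeff m P := fun m hm =>
    lt_of_le_of_ne (hP m) (Ne.symm (mem_support_iff.1 hm))
  have hBS : B ∈ P.support := mem_support_iff.2 hB
  have h := tendsto_log_coeff_div_iInf hc hBS
  have hP' : poly P.support (fun m => coeff m P) = P := P.as_sum.symm
  rwa [hP'] at h

/-- The infimum is positive: `⨅_u tilt ≥ [x^B] P > 0` (the `α = B` term). -/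
theorem iInf_tilt_pos {S : Finset (Fin d →₀ ℕ)} {c : (Fin d →₀ ℕ) → ℝ} (hc : ∀ α ∈ S, 0 < c α) {B : Fin d →₀ ℕ}
    (hB : B ∈ S) : 0 < ⨅ u : Fin d → ℝ, tilt S c B u := by
  have hne : S.Nonempty := ⟨B, hB⟩
  have h : ∀ u, c B ≤ tilt S c B u := fun u => by
    have := term_le_tilt hc B u hB
    rwa [show dot B B u = 0 by simp [dot, dvec_self], Real.exp_zero, mul_one] at this
  exact lt_of_lt_of_le (hc B hB) (le_ciInf h)

end CoeffAsymp

end Summit.KontsevichZagierPeriods.Zeta5Search.Families.Cellular
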